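import Summits.Ventures.HSemireg.WedgeHankelRecurrenceGaussStieltjesPade

/-!
# Venture HSemireg — **SZEGŐ'S THEOREM 3.3.3 FOR A POSITIVE RECURRENCE: between two consecutive zeros of `q_{m+1}` lies a zero of every `q_{n+1}` with `n > m`** — a SYNTHESIS of the chapter:
# Favard (N281) puts a positive measure on the zeros of `q_{n+1}` for which `q_0, …, q_n` are orthogonal; pairwise orthogonality upgrades to orthogonality of `q_{m+1}` against every lower-degree
# polynomial; Gauss–Jacobi (N265) makes the zeros of `q_{m+1}` with their Christoffel weights an exact rule of degree `2m + 1` for that measure; and N272 (every open Gauss gap holds a node of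
# the measure) finishes

HONEST FRAMING. Part of the Lean index of the computation cell `pub-hsemireg` (seat p10 gen 42, Sunday typer «UNIFORM-IN-n»).  Real polynomials and finite sums only, on top of N265 ∕ N268 ∕
N272 ∕ N279 ∕ N281; no variety, no cohomology theory, no sheaf, no Ext group and no semiregularity map is constructed here; nothing here says that HC / HC_CM / HC_AV holds; no Literature fact
(unproved `Prop`) is declared or used.  Custodian versions as in `WedgeHankelSiegelIdeal` (1/3).
SOURCES (cited).  G. Szegő, *Orthogonal Polynomials*, AMS Colloq. Publ. 23, Thm 3.3.3 («let `z_1 < z_2` be two zeros of `p_m`; then each `p_n`, `n > m`, has at least one zero in `[z_1, z_2]`»;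
here the open interval, via Thm 3.41.2's mechanism); T. S. Chihara, *An Introduction to Orthogonal Polynomials* (1978), Ch. I Thm 5.3 and §6; J. Favard 1935.
PROOF TYPED HERE.  As in the title.  The upgrade «pairwise orthogonal ⇒ orthogonal to all lower degrees» is an induction on the degree (`G = c q_d + G′`).
DEDUP DISCLOSURE (`rg -n 'zeros_separate|between two zeros' Summits/Ventures/HSemireg/WedgeHankelRecurrenceGauss*`, 2026-09-02): N279 gives CONSECUTIVE degrees only; N272 is the
measure-side statement.  The 3 names below: 0 hits tree-wide.

WHAT IS IN THE TREE.  N265 `sum_mul_eval_eq_of_orthogonal`; N268 `exists_node_ne_of_lt_card`; N272 `exists_bigNode_mem_gaussGap`; N279 `recurrence_zeros`, `recurrence_monic_natDegree`,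
`eq_prod_X_sub_C_of_monic_of_roots`; N281 `favard_finite_explicit`; N269 `natDegree_sub_C_mul_le_of_monic`.
THIS FILE (namespace `Summit.Ventures.HSemireg.Wedge.HankelOuter` continued; CHAINED on N284 (import) and the files above; 0 definitions):
* §1050 `orthogonal_lower_of_pairwise` (pairwise orthogonality of `q_0, …, q_n` ⇒ `q_d ⊥` every `G` with `deg G < d`, `d ≤ n`), `recurrence_gauss_rule_of_favard` (the zeros of `q_{m+1}` with
  their Christoffel weights integrate degree `≤ 2m + 1` exactly against the Favard measure of level `n ≥ m + 1`), **`recurrence_zeros_separate`** (SZEGŐ THM 3.3.3: every open gap between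
  consecutive zeros of `q_{m+1}` contains a zero of `q_{n+1}`, `n > m`).
CAVEATS.  Nothing Ext-side.  New names only.
-/

open Module Polynomial
open scoped Matrix Polynomial

namespace Summit.Ventures.HSemireg.Wedge.HankelOuter

/-! ## §1050. Separation of zeros across degrees -/

/-- **Pairwise orthogonal ⇒ orthogonal to all lower degrees**: if `q_d` is monic of degree `d` for `d ≤ n` and `Σ_l μ_l q_i(y_l) q_j(y_l) = 0` for `i ≠ j ≤ n`, then for `d ≤ n` and every `G`
with `deg G < d`: `Σ_l μ_l (q_d G)(y_l) = 0`. [bookkeeping; this file, §1050] -/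
theorem orthogonal_lower_of_pairwise {N n : ℕ} {μ y : Fin N → ℝ} {q : ℕ → ℝ[X]} (hmonic : ∀ d, d ≤ n → (q d).Monic) (hdeg : ∀ d, d ≤ n → (q d).natDegree = d)
    (hpair : ∀ i j, i ≤ n → j ≤ n → i ≠ j → ∑ l, μ l * ((q i).eval (y l) * (q j).eval (y l)) = 0) {d : ℕ} (hd : d ≤ n) {G : ℝ[X]} (hG : G.natDegree < d) :
    ∑ l, μ l * (q d * G).eval (y l) = 0 := by
  -- induction on an upper bound `e` of `deg G`, `e < d`
  have key : ∀ e, e < d → ∀ G : ℝ[X], G.natDegree ≤ e → ∑ l, μ l * (q d * G).eval (y l) = 0 := by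
    intro e
    induction e with
    | zero =>
      intro he G hG
      have hG0 : G = C (G.coeff 0) := eq_C_of_natDegree_le_zero hG
      have hq0 : q 0 = 1 := eq_one_of_monic_natDegree_zero (hmonic 0 (by omega)) (hdeg 0 (by omega))
      have h := hpair d 0 hd (by omega) (by omega)
      rw [hq0] at h
      simp only [eval_one, mul_one] at h
      rw [hG0]
      simp only [eval_mul, eval_C]
      rw [show ∑ l, μ l * ((q d).eval (y l) * G.coeff 0) = G.coeff 0 * ∑ l, μ l * (q d).eval (y l) by rw [Finset.mul_sum]; exact Finset.sum_congr rfl fun l _ => by ring, h, mul_zero]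
    | succ e ih =>
      intro he G hG
      set c := G.coeff (e + 1) with hc
      set G' := G - C c * q (e + 1) with hG'
      have hG'd : G'.natDegree ≤ e := by
        have := natDegree_sub_C_mul_le_of_monic hG (hmonic (e + 1) (by omega)) (hdeg (e + 1) (by omega))
        simpa using this
      have h1 := ih (by omega) G' hG'd
      have h2 := hpair d (e + 1) hd (by omega) (by omega)
      have e1 : ∀ l, μ l * (q d * G).eval (y l) = μ l * (q d * G').eval (y l) + c * (μ l * ((q d).eval (y l) * (q (e + 1)).eval (y l))) := fun l => by
        rw [hG']; simp only [eval_mul, eval_sub, eval_C]; ring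
      rw [Finset.sum_congr rfl fun l _ => e1 l, Finset.sum_add_distrib, ← Finset.mul_sum, h1, h2, mul_zero, add_zero]
  rcases Nat.eq_zero_or_pos d with h0 | hpos
  · omega
  · exact key (d - 1) (by omega) G (by omega)

/-- **The zeros of `q_{m+1}` form a Gauss rule of the level-`n` Favard measure** (`m + 1 ≤ n`): with `μ` the Favard weights on the zeros `y` of `q_{n+1}` and `λ_k = Σ_l μ_l ℓ_k(y_l)` the
Christoffel weights of the zeros `z` of `q_{m+1}`, `Σ_k λ_k F(z_k) = Σ_l μ_l F(y_l)` for every `F` with `deg F ≤ 2m + 1`. [Szegő Thm 3.4.1; Chihara I §6; this file, §1050] -/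
theorem recurrence_gauss_rule_of_favard {q : ℕ → ℝ[X]} {a b : ℕ → ℝ} (hq0 : q 0 = 1) (hq1 : q 1 = Polynomial.X - C (a 0))
    (hrec : ∀ n, q (n + 2) = (Polynomial.X - C (a (n + 1))) * q (n + 1) - C (b (n + 1)) * q n) {m n : ℕ} (hmn : m + 1 ≤ n)
    {y μ : Fin (n + 1) → ℝ} (hpair : ∀ i j : Fin (n + 1), ∑ l, μ l * ((q i).eval (y l) * (q j).eval (y l)) = if i = j then ∏ l ∈ Finset.Ico 1 ((j : ℕ) + 1), b l else 0)
    {z : Fin (m + 1) → ℝ} (hz : StrictMono z) (hzr : ∀ k, (q (m + 1)).eval (z k) = 0) {F : ℝ[X]} (hF : F.natDegree ≤ 2 * m + 1) :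
    ∑ k, (∑ l, μ l * (Lagrange.basis Finset.univ z k).eval (y l)) * F.eval (z k) = ∑ l, μ l * F.eval (y l) := by
  obtain ⟨hQm, hQd⟩ := recurrence_monic_natDegree hq0 hq1 hrec (m + 1)
  have hQ := eq_prod_X_sub_C_of_monic_of_roots hQm hQd hz.injective hzr
  -- pairwise orthogonality with natural-number indices `≤ n`
  have hpair' : ∀ i j, i ≤ n → j ≤ n → i ≠ j → ∑ l, μ l * ((q i).eval (y l) * (q j).eval (y l)) = 0 := fun i j hi hj hij => by
    have h := hpair ⟨i, Nat.lt_succ_of_le hi⟩ ⟨j, Nat.lt_succ_of_le hj⟩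
    rwa [if_neg (fun e => hij (by simpa using congrArg Fin.val e))] at h
  have horth : ∀ G : ℝ[X], G.natDegree ≤ m → ∑ l, μ l * ((∏ j, (Polynomial.X - C (z j))) * G).eval (y l) = 0 := fun G hG => by
    rw [← hQ]
    exact orthogonal_lower_of_pairwise (fun d _ => (recurrence_monic_natDegree hq0 hq1 hrec d).1) (fun d _ => (recurrence_monic_natDegree hq0 hq1 hrec d).2) hpair' hmn (by omega)
  exact sum_mul_eval_eq_of_orthogonal hz.injective horth (fun k => rfl) hF

/-- **SZEGŐ'S THEOREM 3.3.3 (positive recurrence)**: for `m < n`, every open gap between consecutive zeros of `q_{m+1}` contains a zero of `q_{n+1}`.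
[Szegő Thm 3.3.3; Chihara I Thm 5.3; this file, §1050] -/
theorem recurrence_zeros_separate {q : ℕ → ℝ[X]} {a b : ℕ → ℝ} (hq0 : q 0 = 1) (hq1 : q 1 = Polynomial.X - C (a 0))
    (hrec : ∀ n, q (n + 2) = (Polynomial.X - C (a (n + 1))) * q (n + 1) - C (b (n + 1)) * q n) (hb : ∀ j, 0 < b j) {m n : ℕ} (hmn : m < n)
    {z : Fin (m + 1) → ℝ} (hz : StrictMono z) (hzr : ∀ k, (q (m + 1)).eval (z k) = 0) {y : Fin (n + 1) → ℝ} (hy : StrictMono y) (hyr : ∀ l, (q (n + 1)).eval (y l) = 0)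
    (k : Fin m) : ∃ l, z k.castSucc < y l ∧ y l < z k.succ := by
  -- the Favard measure of level `n` on the zeros `y` (its own zero vector agrees with `y`)
  obtain ⟨y', hy', hy'r, hμpos, -, hpair⟩ := favard_finite_explicit hq0 hq1 hrec hb n
  -- `y' = y`: both are the increasing enumeration of the zeros of `q_{n+1}`
  obtain ⟨hPm, hPd⟩ := recurrence_monic_natDegree hq0 hq1 hrec (n + 1)
  have hP := eq_prod_X_sub_C_of_monic_of_roots hPm hPd hy.injective hyr
  have hyy : y' = y := by
    have h1 : ∀ i, y' i ∈ Set.range y := fun i => by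
      have := hy'r i
      rw [hP, eval_prod, Finset.prod_eq_zero_iff] at this
      obtain ⟨l, -, hl⟩ := this
      rw [eval_sub, eval_X, eval_C, sub_eq_zero] at hl
      exact ⟨l, hl.symm⟩
    have hsub : Finset.univ.image y' ⊆ Finset.univ.image y := fun x hx => by
      obtain ⟨i, -, rfl⟩ := Finset.mem_image.1 hx
      obtain ⟨l, hl⟩ := h1 i
      exact Finset.mem_image.2 ⟨l, Finset.mem_univ _, hl⟩
    have hcard : (Finset.univ.image y).card ≤ (Finset.univ.image y').card := by
      rw [Finset.card_image_of_injective _ hy.injective, Finset.card_image_of_injective _ hy'.injective]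
    have heq := Finset.eq_of_subset_of_card_le hsub hcard
    have hrange : Set.range y' = Set.range y := by
      rw [← Set.image_univ, ← Set.image_univ, ← Finset.coe_univ, ← Finset.coe_image, ← Finset.coe_image, heq]
    exact (hy'.range_inj hy).1 hrange
  subst hyy
  set μ : Fin (n + 1) → ℝ := fun l => (∏ l' ∈ Finset.Ico 1 (n + 1), b l') / ((derivative (q (n + 1))).eval (y' l) * (q n).eval (y' l)) with hμ
  -- the Gauss rule of `μ` on the zeros of `q_{m+1}`
  have hmom : ∀ p, p ≤ 2 * m → ∑ k, (∑ l, μ l * (Lagrange.basis Finset.univ z k).eval (y' l)) * z k ^ p = ∑ l, μ l * y' l ^ p := fun p hp => by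
    have h := recurrence_gauss_rule_of_favard hq0 hq1 hrec (Nat.succ_le_of_lt hmn) hpair hz hzr (F := Polynomial.X ^ p) (by rw [natDegree_X_pow]; omega)
    simpa only [eval_pow, eval_X] using h
  -- a node of `μ` with positive weight outside the zeros of `q_{m+1}`
  obtain ⟨l₀, hl₀⟩ := exists_node_ne_of_lt_card (v := z) hy'.injective (by omega)
  obtain ⟨l, -, h1, h2⟩ := exists_bigNode_mem_gaussGap hz (fun l => (hμpos l).le) (hμpos l₀) hl₀ hmom k
  exact ⟨l, h1, h2⟩

end Summit.Ventures.HSemireg.Wedge.HankelOuter
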